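import Mathlib
import Summits.Ventures.PercRepro2.A3BetweenCovarianceAll

/-!
# The conditional covariance given the revealed cluster `C(a₃)` is the fibre-mean covariance
(blind cell PercRepro2, typer-1 g17; parts I–III `A3Between*.lean` on p5 g12's `A3Fibre.lean`;
the lead's word 2026-08-26T22:16:25Z — part IV-a)

With `𝒢 = σ(C(a₃))` (`clusterSigma`) and `μ_A = (percMeasureOf p hp)[|A]`, the conditional
covariance given a σ-algebra in Mathlib's `condVar` pattern is
`condCovSigma m X Y μ = μ[(X − μ[X | m]) (Y − μ[Y | m]) | m]`.  On the finite configuration space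
it is the fibre-mean covariance `condCovMean = E[fg | 𝒢] − E[f | 𝒢] E[g | 𝒢]`
(**`condCovSigma_ae_eq_condCovMean`**, a.e. under `μ_A`, by `condExp_congr_ae` and part I's
`condMean_ae_eq_condExp`; the centred fibre product expands on every fibre,
`condMean_centered_mul`), and its `A`-mass is the sum of the fibre covariance masses
`fibreCov W = E[1_{A∩W} fg] − E[1_{A∩W} f] E[1_{A∩W} g] / P(A ∩ W)` (`expect_indicator_condCovMean`):
**`prob_mul_integral_condCovSigma`**: `P(A) · μ_A[Cov(f, g | 𝒢)] = ∑_W fibreCov W` for every weight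
vector (both sides vanish on a null `A`).  Part IV-b (`A3WithinCovariance.lean`) identifies the fibre
covariance masses with p5's fibre slacks and states the law of total covariance.

A LANGUAGE line (identities): the crux of record and the residual (MEANS-a₃) are unmoved.
-/

namespace Summit.Ventures.PercRepro2

open UnionCluster MeasureTheory ProbabilityTheory MeasureBridge

namespace CovForm

namespace A3Means

/-! ## Conditional covariance given a σ-algebra, and its fibre form -/

section General

variable {Ω : Type*} {m₀ : MeasurableSpace Ω}

/-- The conditional covariance of `X` and `Y` given `m` (Mathlib's `condVar` pattern with two
arguments): `μ[(X − μ[X | m]) (Y − μ[Y | m]) | m]`; `0` under the same degeneracies as `condExp`. -/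
noncomputable def condCovSigma (m : MeasurableSpace Ω) (X Y : Ω → ℝ) (μ : Measure[m₀] Ω) : Ω → ℝ :=
  μ[fun ω => (X ω - (μ[X | m]) ω) * (Y ω - (μ[Y | m]) ω) | m]

end General

section Defs

variable {V : Type*} {E : Type*} [Fintype V] [DecidableEq V] [Fintype E] [DecidableEq E]

/-- The fibre-mean conditional covariance of `f` and `g` given the revealed cluster under the
conditioning `A`: `E[fg | 𝒢] − E[f | 𝒢] E[g | 𝒢]` with the fibre means. -/
noncomputable def condCovMean (p : E → ℝ) (ends : E → Sym2 V) (a₃ : V) (A : Set (Config E))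
    (f g : Config E → ℝ) : Config E → ℝ :=
  fun ω => condMean p ends a₃ A (fun ω => f ω * g ω) ω -
    condMean p ends a₃ A f ω * condMean p ends a₃ A g ω

/-- The covariance mass of `f, g` on the `A`-fibre `W`:
`E[1_{A∩W} fg] − E[1_{A∩W} f] E[1_{A∩W} g] / P(A ∩ W)` (`= P(A ∩ W) · Cov_W(f, g)`; `0` on a null
fibre). -/
noncomputable def fibreCov (p : E → ℝ) (ends : E → Sym2 V) (a₃ : V) (A : Set (Config E))
    (f g : Config E → ℝ) (W : Finset V) : ℝ :=
  fibreExpect p ends a₃ A (fun ω => f ω * g ω) W -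
    fibreExpect p ends a₃ A f W * fibreExpect p ends a₃ A g W /
      prob p (A ∩ clusterEvent ends a₃ (↑W : Set V))

end Defs

/-! ## The fibre computation -/

section Fibre

variable {V : Type*} {E : Type*} [Fintype V] [DecidableEq V] [Fintype E] [DecidableEq E]

/-- On the `A`-fibre `W` the conditional means are the constants `fibreMean … W`. -/
lemma fibreExpect_centered (p : E → ℝ) (ends : E → Sym2 V) (a₃ : V) (A : Set (Config E))
    (f g : Config E → ℝ) (W : Finset V) :
    fibreExpect p ends a₃ A
        (fun ω => (f ω - condMean p ends a₃ A f ω) * (g ω - condMean p ends a₃ A g ω)) W =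
      fibreExpect p ends a₃ A
        (fun ω => (f ω - fibreMean p ends a₃ A f W) * (g ω - fibreMean p ends a₃ A g W)) W := by
  unfold fibreExpect expect
  refine Finset.sum_congr rfl fun ω _ => ?_
  beta_reduce
  by_cases hω : ω ∈ A ∩ clusterEvent ends a₃ (↑W : Set V)
  · rw [condMean_of_mem p ends a₃ A f hω.2, condMean_of_mem p ends a₃ A g hω.2]
  · simp [Set.indicator_of_notMem hω]

omit [Fintype V] [DecidableEq V] in
/-- Expanding the centred product on a fibre. -/
lemma fibreExpect_centered_const (p : E → ℝ) (ends : E → Sym2 V) (a₃ : V) (A : Set (Config E))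
    (f g : Config E → ℝ) (W : Finset V) (c d : ℝ) :
    fibreExpect p ends a₃ A (fun ω => (f ω - c) * (g ω - d)) W =
      fibreExpect p ends a₃ A (fun ω => f ω * g ω) W - d * fibreExpect p ends a₃ A f W -
        c * fibreExpect p ends a₃ A g W + c * d * prob p (A ∩ clusterEvent ends a₃ (↑W : Set V)) := by
  unfold fibreExpect
  rw [prob_eq_expect_indicator]
  unfold expect
  simp only [Finset.mul_sum, ← Finset.sum_sub_distrib, ← Finset.sum_add_distrib]
  refine Finset.sum_congr rfl fun ω _ => ?_
  ring

/-- **The fibre mean of the centred product is the fibre covariance**: pointwise,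
`E[(f − E[f|𝒢])(g − E[g|𝒢]) | 𝒢] = E[fg | 𝒢] − E[f|𝒢] E[g|𝒢]` with the fibre means. -/
lemma condMean_centered_mul (p : E → ℝ) (ends : E → Sym2 V) (a₃ : V) (A : Set (Config E))
    (f g : Config E → ℝ) (ω : Config E) :
    condMean p ends a₃ A
        (fun ω => (f ω - condMean p ends a₃ A f ω) * (g ω - condMean p ends a₃ A g ω)) ω =
      condCovMean p ends a₃ A f g ω := by
  unfold condCovMean
  change fibreMean p ends a₃ A
      (fun ω => (f ω - condMean p ends a₃ A f ω) * (g ω - condMean p ends a₃ A g ω))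
      (clusterMap ends a₃ ω) =
    fibreMean p ends a₃ A (fun ω => f ω * g ω) (clusterMap ends a₃ ω) -
      fibreMean p ends a₃ A f (clusterMap ends a₃ ω) * fibreMean p ends a₃ A g (clusterMap ends a₃ ω)
  set W := clusterMap ends a₃ ω
  unfold fibreMean
  rw [fibreExpect_centered, fibreExpect_centered_const]
  unfold fibreMean
  set P := prob p (A ∩ clusterEvent ends a₃ (↑W : Set V))
  by_cases hP : P = 0
  · simp [hP]
  · field_simp
    ring

/-- The `A`-mass of the fibre-mean conditional covariance is the sum of the fibre covariance
masses: `E[1_A · (E[fg|𝒢] − E[f|𝒢] E[g|𝒢])] = ∑_W fibreCov W`. -/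
lemma expect_indicator_condCovMean {p : E → ℝ} (hp : IsProbVec p) (ends : E → Sym2 V) (a₃ : V)
    (A : Set (Config E)) (f g : Config E → ℝ) :
    expect p (fun ω => A.indicator 1 ω * condCovMean p ends a₃ A f g ω) =
      ∑ W : Finset V, fibreCov p ends a₃ A f g W := by
  have h : (fun ω => A.indicator 1 ω * condCovMean p ends a₃ A f g ω) =
      (fun ω => A.indicator 1 ω * condMean p ends a₃ A (fun ω => f ω * g ω) ω) -
        (fun ω => A.indicator 1 ω * (condMean p ends a₃ A f ω * condMean p ends a₃ A g ω)) := by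
    funext ω
    simp only [condCovMean, Pi.sub_apply]
    ring
  rw [h, expect_sub, expect_indicator_condMean hp, expect_indicator_condMean_mul,
    ← Finset.sum_sub_distrib]
  rfl

omit [Fintype V] [DecidableEq V] in
/-- On a null fibre every covariance mass vanishes. -/
lemma fibreCov_eq_zero_of_prob_eq_zero {p : E → ℝ} (hp : IsProbVec p) (ends : E → Sym2 V) (a₃ : V)
    (A : Set (Config E)) (f g : Config E → ℝ) (W : Finset V)
    (h : prob p (A ∩ clusterEvent ends a₃ (↑W : Set V)) = 0) :
    fibreCov p ends a₃ A f g W = 0 := by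
  unfold fibreCov fibreExpect
  rw [expect_indicator_mul_eq_zero hp h, expect_indicator_mul_eq_zero hp h,
    expect_indicator_mul_eq_zero hp h]
  simp

/-- The fibre masses sum to the `A`-mass: `∑_W E[1_{A∩W} h] = E[1_A h]`. -/
lemma sum_fibreExpect (p : E → ℝ) (ends : E → Sym2 V) (a₃ : V) (A : Set (Config E))
    (h : Config E → ℝ) :
    ∑ W : Finset V, fibreExpect p ends a₃ A h W = expect p (fun ω => A.indicator 1 ω * h ω) := by
  rw [expect_eq_sum_clusters p ends a₃ (fun ω => A.indicator 1 ω * h ω)]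
  refine Finset.sum_congr rfl fun W _ => ?_
  unfold fibreExpect
  congr 1
  funext ω
  rw [indicator_inter_one]
  ring

end Fibre

/-! ## The bridge to Mathlib's conditional expectation -/

section Bridge

variable {V : Type*} {E : Type*} [Fintype V] [DecidableEq V] [Fintype E] [DecidableEq E]

/-- **The conditional covariance given `σ(C(a₃))` is the fibre-mean covariance** (a.e. under
`μ[|A]`): `Cov(f, g | 𝒢) = E[fg | 𝒢] − E[f | 𝒢] E[g | 𝒢]` with the fibre means. -/
theorem condCovSigma_ae_eq_condCovMean (p : E → ℝ) (hp : IsProbVec p) (ends : E → Sym2 V) (a₃ : V)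
    (A : Set (Config E)) (f g : Config E → ℝ) :
    condCovSigma (clusterSigma ends a₃) f g ((percMeasureOf p hp)[|A]) =ᵐ[(percMeasureOf p hp)[|A]]
      condCovMean p ends a₃ A f g := by
  have hf := condMean_ae_eq_condExp p hp ends a₃ A f
  have hg := condMean_ae_eq_condExp p hp ends a₃ A g
  have hint : (fun ω => (f ω - (((percMeasureOf p hp)[|A])[f | clusterSigma ends a₃]) ω) *
      (g ω - (((percMeasureOf p hp)[|A])[g | clusterSigma ends a₃]) ω)) =ᵐ[(percMeasureOf p hp)[|A]]
      (fun ω => (f ω - condMean p ends a₃ A f ω) * (g ω - condMean p ends a₃ A g ω)) :=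
    (hf.and hg).mono fun ω h => by simp only [h.1, h.2]
  unfold condCovSigma
  refine (condExp_congr_ae hint).trans ?_
  refine (condMean_ae_eq_condExp p hp ends a₃ A _).symm.trans ?_
  exact Filter.Eventually.of_forall (condMean_centered_mul p ends a₃ A f g)

/-- `P(A) · μ_A[Cov(f, g | 𝒢)] = ∑_W fibreCov W` — every weight vector (both sides vanish on a null
`A`). -/
theorem prob_mul_integral_condCovSigma (p : E → ℝ) (hp : IsProbVec p) (ends : E → Sym2 V) (a₃ : V)
    (A : Set (Config E)) (f g : Config E → ℝ) :
    prob p A * ∫ ω, condCovSigma (clusterSigma ends a₃) f g ((percMeasureOf p hp)[|A]) ω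
        ∂((percMeasureOf p hp)[|A]) =
      ∑ W : Finset V, fibreCov p ends a₃ A f g W := by
  rw [integral_congr_ae (condCovSigma_ae_eq_condCovMean p hp ends a₃ A f g)]
  by_cases hA : prob p A = 0
  · rw [hA, zero_mul]
    symm
    refine Finset.sum_eq_zero fun W _ => fibreCov_eq_zero_of_prob_eq_zero hp ends a₃ A f g W ?_
    exact le_antisymm ((prob_inter_le_left hp A _).trans hA.le) (prob_nonneg hp _)
  · rw [integral_cond_percMeasureOf, expect_indicator_condCovMean hp, mul_inv_cancel_left₀ hA]

end Bridge

end A3Means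

end CovForm

end Summit.Ventures.PercRepro2
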